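import Summits.MatrixMultiplication.MatrixMultiplication.Theorems.SoloInformedTwoRows

/-!
# Two value-constant columns of `a` pay `n · |K ∖ K_exc| · |I*| ≤ r · |S⁰|` (every chart)

This work, §8.8 (T12) (gen 107), THEOREM 8.16′ — the `a`-side twin of `SoloInformedTwoRows`. If two columns
`j`, `j'` of `a` are class-constant on a common row set `I*` with INEQUIVALENT classes `α ≁ α'`, then for every `k` the
row `c(k, ·)` restricted to `I*` lies in `{[b j k ± α]} ∩ {[b j' k ± α']}`, a single class unless
`b j' k ~ α ∧ b j k ~ α'` (`signEq_of_mem_inter₂`); so every non-exceptional row `k` of `c` is class-constant on `I*`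
and the second laziness bound `Data.card_mul_le_of_c_rowsOn₂` gives
`Data.card_mul_le_of_two_cols : n · |K₁| · |I*| ≤ r · |S⁰|` for any `K₁` avoiding the exceptional rows of `b`.
Also `Adm.swap` (symmetry of admissibility in its first two slots). References: this work §8.8; CohnUmans2013 Def. 12.
-/

namespace Summit.MatrixMultiplication.MatrixMultiplication.Theorems.TwistedTPP

namespace FibreLines

variable {ι G : Type*} [AddCommGroup G]

/-- `Adm` is symmetric in its first two slots. -/
theorem Adm.swap {x v w : G} (h : Adm x v w) : Adm v x w := by
  rcases h with h | h | h | h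
  · exact Or.inl (by rw [← h]; abel)
  · exact Or.inr (Or.inl (by rw [← h]; abel))
  · refine Or.inr (Or.inr (Or.inr ?_))
    rw [← neg_eq_zero, ← h]; abel
  · refine Or.inr (Or.inr (Or.inl ?_))
    rw [← neg_eq_zero, ← h]; abel

variable {G₀ R : Type*} [AddCommGroup G₀]

/-- **THEOREM 8.16′ (two value-constant columns of `a`, every chart).** If columns `j`, `j'` of `a` are
class-constant on `I*` with inequivalent classes `α ≁ α'`, and `K₁` avoids the exceptional rows
`{k : b j' k ~ α ∧ b j k ~ α'}` of `b`, then `n · |K₁| · |I*| ≤ r · |S⁰|`. [this work, §8.8 (T12)] -/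
theorem Data.card_mul_le_of_two_cols [Fintype ι] [DecidableEq ι] [Fintype G₀] [DecidableEq G₀]
    [Fintype R] [DecidableEq R] (hG : ∀ x : G, x = -x → x = 0) (D : Data ι G) (Φ : Chart ι G₀) (κ : G → R)
    (hκ : ∀ x y, κ x = κ y → SignEq x y) (hsep : D.SepAll Φ) {j j' : ι} {α α' : G} (hαα : ¬ SignEq α α')
    (Is K₁ : Finset ι) (hj : ∀ i ∈ Is, SignEq (D.a i j) α) (hj' : ∀ i ∈ Is, SignEq (D.a i j') α')
    (hK : ∀ k ∈ K₁, ¬ (SignEq α (D.b j' k) ∧ SignEq α' (D.b j k))) :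
    Fintype.card ι * K₁.card * Is.card ≤ Fintype.card R * Fintype.card G₀ := by
  refine D.card_mul_le_of_c_rowsOn₂ Φ κ hκ hsep Is K₁ ?_
  intro k hk i hi i'' hi''
  have e1 : ∀ i ∈ Is, SignEq (D.c k i) (D.b j k + α) ∨ SignEq (D.c k i) (D.b j k - α) := fun i hi =>
    (((D.adm_eqn i j k).of_signEq_left (hj i hi)).swap).signEq_add_or_sub
  have e2 : ∀ i ∈ Is, SignEq (D.c k i) (D.b j' k + α') ∨ SignEq (D.c k i) (D.b j' k - α') := fun i hi =>
    (((D.adm_eqn i j' k).of_signEq_left (hj' i hi)).swap).signEq_add_or_sub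
  exact signEq_of_mem_inter₂ hG hαα (hK k hk) (e1 i hi) (e2 i hi) (e1 i'' hi'') (e2 i'' hi'')

/-- **THEOREM 8.16 + 8.16′ combined form ("two lines suffice").** A common column set `K*` on which two rows of `b`
take inequivalent constant classes, OR a common row set `I*` on which two columns of `a` take inequivalent constant
classes, pays `n · (line set) · (non-exceptional set) ≤ r · |S⁰|`. [this work, §8.8 (T12)] -/
theorem Data.card_mul_le_of_two_lines [Fintype ι] [DecidableEq ι] [Fintype G₀] [DecidableEq G₀]
    [Fintype R] [DecidableEq R] (hG : ∀ x : G, x = -x → x = 0) (D : Data ι G) (Φ : Chart ι G₀) (κ : G → R)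
    (hκ : ∀ x y, κ x = κ y → SignEq x y) (hsep : D.SepAll Φ) {j j' : ι} {v v' : G} (hvv : ¬ SignEq v v')
    (S E : Finset ι)
    (h : (∀ k ∈ S, SignEq (D.b j k) v) ∧ (∀ k ∈ S, SignEq (D.b j' k) v') ∧
        (∀ i ∈ E, ¬ (SignEq v (D.a i j') ∧ SignEq v' (D.a i j))) ∨
      (∀ i ∈ S, SignEq (D.a i j) v) ∧ (∀ i ∈ S, SignEq (D.a i j') v') ∧
        (∀ k ∈ E, ¬ (SignEq v (D.b j' k) ∧ SignEq v' (D.b j k)))) :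
    Fintype.card ι * E.card * S.card ≤ Fintype.card R * Fintype.card G₀ := by
  rcases h with ⟨hj, hj', hE⟩ | ⟨hj, hj', hE⟩
  · exact D.card_mul_le_of_two_rows hG Φ κ hκ hsep hvv E S hj hj' hE
  · exact D.card_mul_le_of_two_cols hG Φ κ hκ hsep hvv S E hj hj' hE

end FibreLines

end Summit.MatrixMultiplication.MatrixMultiplication.Theorems.TwistedTPP
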